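import Mathlib
import Literature.Computability.AlgebraicComplexity.LinSubst
import Summits.ValiantsHypothesis.ValiantsHypothesis.Theorems.BorderApolarityToricFixedPointsToricLimitIsInitialAux1
import Summits.ValiantsHypothesis.ValiantsHypothesis.Theorems.BorderApolarityToricFixedPointsCellRetractionAux2
import Summits.ValiantsHypothesis.ValiantsHypothesis.Theorems.BorderApolarityFixedWitnessObstructionQPH0Elementary
import Summits.ValiantsHypothesis.ValiantsHypothesis.Theorems.BorderApolarityBorelFixedBorderApolarityWeightsB

/-!
# Border apolarity, support item `BorelFixedBorderApolarity` — the group `H₀`: triangularity, lowering, torus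

Route `ValiantsHypothesis/BorderApolarity`, support item `stmt-ValiantsHypothesis-5781`, helper
file.  The stability clause W4 of the item asks that `D ↦ Mᵀ · D` preserve each `J k` for every
invertible `M` which is (a) triangular for the order `rk`, (b) diagonal on the own columns,
(c) rank-one on the block diagonal, (d) of character one.  Here:

* `bfba_det_eq_prod_diag` — a matrix triangular for an injective grading has
  `det = ∏ diagonal` (Mathlib's `BlockTriangular.det` with singleton blocks); hence the diagonal of
  such an invertible `M` is nowhere zero and `Mᵀ = V · diag(M)` with `V` UNIPOTENT lower
  triangular, supported on the rows of the unused variables;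
* `bfba_lowering` — for a weight `μ` with `μ a < μ b` whenever `V a b ≠ 0`, `a ≠ b` (anti-dominance),
  the substitution `linSubst V` is LOWERING: it changes a polynomial with weights `≤ ν` by terms of
  weight `< ν` (multiplicativity of the weight filtration);
* `bfba_torus_stable` — a `μ`-graded subspace of degree-`k` forms (`k ≤ m`) is stable under
  `diag(d)` for every nowhere-zero `d` with the rank-one block pattern, by the genericity property
  of `μ` (`bfba_exists_weight`, clause 4);
* `bfba_W4_of_graded_of_unipotent` — W4 follows from gradedness plus stability under the
  unipotent `V`'s.

Folklore linear algebra.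
-/

open MvPolynomial
open scoped BigOperators Matrix

namespace Summit.ValiantsHypothesis.ValiantsHypothesis.Theorems.BorderApolarityBorelFixedBorderApolarity

set_option linter.dupNamespace false

open Literature.Computability.AlgebraicComplexity
open Summit.ValiantsHypothesis.ValiantsHypothesis.Theorems.BorderApolarityToricFixedPoints
open Summit.ValiantsHypothesis.ValiantsHypothesis.Theorems.BorderApolarityFixedWitnessObstructionQP
  (fst_mul_add_snd_lt)

/-! ## Triangular matrices for an injective grading -/

/-- **`det = ∏ diagonal` for a matrix triangular with respect to an injective grading** (the blocks
of `Matrix.BlockTriangular.det` are singletons). [folklore] -/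
theorem bfba_det_eq_prod_diag {σ : Type} [Fintype σ] [DecidableEq σ] {α : Type} [LinearOrder α]
    (b : σ → α) (hb : Function.Injective b) (M : Matrix σ σ ℂ) (hM : M.BlockTriangular b) :
    M.det = ∏ a, M a a := by
  classical
  rw [hM.det, Finset.prod_image fun x _ y _ h => hb h]
  refine Finset.prod_congr rfl fun a _ => ?_
  haveI : Subsingleton {a' // b a' = b a} := ⟨fun x y => Subtype.ext (hb (x.2.trans y.2.symm))⟩
  rw [Matrix.det_eq_elem_of_subsingleton _ ⟨a, rfl⟩]
  rfl

/-- The order `rk` of the route statement is injective. [folklore] -/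
theorem bfba_rk_injective (n m : ℕ) [NeZero m] :
    Function.Injective fun p : Fin m × Fin m =>
      (if (m - n ≤ (p.1 : ℕ) ∧ m - n ≤ (p.2 : ℕ)) ∨ p = (0, 0) then 0 else m * m) +
        ((p.1 : ℕ) * m + (p.2 : ℕ)) := by
  intro p q h
  simp only at h
  have hp := fst_mul_add_snd_lt p
  have hq := fst_mul_add_snd_lt q
  apply bfba_lin_injective
  split_ifs at h <;> omega

/-- A unit lower-triangular (for the injective order `rk`) matrix has determinant one. [folklore] -/
theorem bfba_det_unipotent {n m : ℕ} [NeZero m] (V : Matrix (Fin m × Fin m) (Fin m × Fin m) ℂ)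
    (hV1 : ∀ a, V a a = 1)
    (hVS : ∀ a b : Fin m × Fin m, a ≠ b → V a b ≠ 0 →
      ¬ ((m - n ≤ (a.1 : ℕ) ∧ m - n ≤ (a.2 : ℕ)) ∨ a = (0, 0)) ∧
        (if (m - n ≤ (b.1 : ℕ) ∧ m - n ≤ (b.2 : ℕ)) ∨ b = (0, 0) then 0 else m * m) +
            ((b.1 : ℕ) * m + (b.2 : ℕ)) <
          (if (m - n ≤ (a.1 : ℕ) ∧ m - n ≤ (a.2 : ℕ)) ∨ a = (0, 0) then 0 else m * m) +
            ((a.1 : ℕ) * m + (a.2 : ℕ))) :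
    V.det = 1 := by
  classical
  have hinj := bfba_rk_injective n m
  have htri : V.BlockTriangular (OrderDual.toDual ∘ fun p : Fin m × Fin m =>
      (if (m - n ≤ (p.1 : ℕ) ∧ m - n ≤ (p.2 : ℕ)) ∨ p = (0, 0) then 0 else m * m) +
        ((p.1 : ℕ) * m + (p.2 : ℕ))) := by
    intro i j hij
    by_contra h
    have hij' := OrderDual.toDual_lt_toDual.1 hij
    have hne : i ≠ j := fun heq => by subst heq; exact lt_irrefl _ hij'
    exact absurd (hVS i j hne h).2 (not_lt.2 hij'.le)
  rw [bfba_det_eq_prod_diag _ (OrderDual.toDual.injective.comp hinj) V htri]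
  exact Finset.prod_eq_one fun a _ => hV1 a
/-- `⟨μ, x_a⟩ = μ a`. [folklore] -/
theorem bfba_weight_single_one {σ : Type} (μ : σ → ℤ) (a : σ) :
    Finsupp.weight μ (Finsupp.single a 1) = μ a := by
  rw [Finsupp.weight_single, one_smul]

/-! ## The weight filtration is multiplicative -/

section Filtration

variable {σ : Type} (μ : σ → ℤ)

/-- Weights of the monomials of a product. [folklore] -/
theorem bfba_weight_of_mem_support_mul {p q : MvPolynomial σ ℂ} {e : σ →₀ ℕ}
    (he : e ∈ (p * q).support) :
    ∃ e₁ ∈ p.support, ∃ e₂ ∈ q.support, Finsupp.weight μ e = Finsupp.weight μ e₁ + Finsupp.weight μ e₂ := by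
  classical
  have h := support_mul p q he
  obtain ⟨e₁, he₁, e₂, he₂, rfl⟩ := Finset.mem_add.1 h
  exact ⟨e₁, he₁, e₂, he₂, map_add _ _ _⟩

/-- `F_{≤α} · F_{≤β} ⊆ F_{≤α+β}`, `F_{<α} · F_{≤β} ⊆ F_{<α+β}`, `F_{≤α} · F_{<β} ⊆ F_{<α+β}`,
packaged as the multiplicativity of the pair property
"weights `≤ α` and `Φ p - p` has weights `< α`" for a multiplicative `Φ`. [folklore] -/
theorem bfba_pair_mul (Φ : MvPolynomial σ ℂ →ₐ[ℂ] MvPolynomial σ ℂ) {p q : MvPolynomial σ ℂ}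
    {α β : ℤ}
    (hp : (∀ e ∈ p.support, Finsupp.weight μ e ≤ α) ∧ ∀ e ∈ (Φ p - p).support, Finsupp.weight μ e < α)
    (hq : (∀ e ∈ q.support, Finsupp.weight μ e ≤ β) ∧ ∀ e ∈ (Φ q - q).support, Finsupp.weight μ e < β) :
    (∀ e ∈ (p * q).support, Finsupp.weight μ e ≤ α + β) ∧
      ∀ e ∈ (Φ (p * q) - p * q).support, Finsupp.weight μ e < α + β := by
  classical
  refine ⟨fun e he => ?_, fun e he => ?_⟩
  · obtain ⟨e₁, he₁, e₂, he₂, h⟩ := bfba_weight_of_mem_support_mul μ he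
    rw [h]
    exact add_le_add (hp.1 e₁ he₁) (hq.1 e₂ he₂)
  · have hΦq : ∀ e ∈ (Φ q).support, Finsupp.weight μ e ≤ β := by
      intro e' he'
      have h1 : Φ q = (Φ q - q) + q := by ring
      rw [h1] at he'
      rcases Finset.mem_union.1 (support_add he') with h2 | h2
      · exact (hq.2 e' h2).le
      · exact hq.1 e' h2
    have hsplit : Φ (p * q) - p * q = (Φ p - p) * Φ q + p * (Φ q - q) := by
      rw [map_mul]; ring
    rw [hsplit] at he
    rcases Finset.mem_union.1 (support_add he) with h2 | h2
    · obtain ⟨e₁, he₁, e₂, he₂, h⟩ := bfba_weight_of_mem_support_mul μ h2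
      rw [h]
      exact add_lt_add_of_lt_of_le (hp.2 e₁ he₁) (hΦq e₂ he₂)
    · obtain ⟨e₁, he₁, e₂, he₂, h⟩ := bfba_weight_of_mem_support_mul μ h2
      rw [h]
      exact add_lt_add_of_le_of_lt (hp.1 e₁ he₁) (hq.2 e₂ he₂)

end Filtration

/-! ## Unipotent anti-dominant substitutions are lowering -/

/-- **Lowering.**  Let `V` have unit diagonal and `μ a < μ b` whenever `V a b ≠ 0`, `a ≠ b`.  Then
for every `D` with `μ`-weights `≤ ν`, the difference `V · D - D` has weights `< ν`: on a variable,
`V · X_b - X_b = Σ_{a ≠ b} V_{ab} X_a` has weights `μ a < μ b`; products by `bfba_pair_mul`; sums.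
[folklore] -/
theorem bfba_lowering {σ : Type} [Fintype σ] [DecidableEq σ] (μ : σ → ℤ) (V : Matrix σ σ ℂ)
    (hV1 : ∀ a, V a a = 1) (hVμ : ∀ a b, a ≠ b → V a b ≠ 0 → μ a < μ b) :
    ∀ (ν : ℤ) (D : MvPolynomial σ ℂ), (∀ e ∈ D.support, Finsupp.weight μ e ≤ ν) →
      ∀ e ∈ (linSubst σ ℂ V D - D).support, Finsupp.weight μ e < ν := by
  classical
  set Φ := linSubst σ ℂ V with hΦ
  -- variables
  have hX : ∀ b : σ, (∀ e ∈ (X b : MvPolynomial σ ℂ).support, Finsupp.weight μ e ≤ μ b) ∧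
      ∀ e ∈ (Φ (X b) - X b).support, Finsupp.weight μ e < μ b := by
    intro b
    refine ⟨fun e he => ?_, fun e he => ?_⟩
    · rw [support_X, Finset.mem_singleton] at he
      rw [he, bfba_weight_single_one]
    · have h1 : Φ (X b) - X b = ∑ a ∈ Finset.univ.erase b, V a b • X a := by
        rw [hΦ, linSubst_X, ← Finset.add_sum_erase _ _ (Finset.mem_univ b), hV1, one_smul,
          add_sub_cancel_left]
      rw [h1] at he
      obtain ⟨a, ha, hea⟩ := Finset.mem_biUnion.1 (support_sum he)
      have hab : a ≠ b := Finset.ne_of_mem_erase ha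
      by_cases hV : V a b = 0
      · rw [hV, zero_smul, support_zero] at hea
        exact absurd hea (Finset.notMem_empty _)
      · have h2 := support_smul hea
        rw [support_X, Finset.mem_singleton] at h2
        rw [h2, bfba_weight_single_one]
        exact hVμ a b hab hV
  -- monomials
  have hmon : ∀ e : σ →₀ ℕ, (∀ e' ∈ (monomial e (1 : ℂ)).support, Finsupp.weight μ e' ≤ Finsupp.weight μ e) ∧
      ∀ e' ∈ (Φ (monomial e 1) - monomial e 1).support, Finsupp.weight μ e' < Finsupp.weight μ e := by
    intro e
    rw [monomial_eq, C_1, one_mul, Finsupp.prod, Finsupp.weight_apply, Finsupp.sum]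
    induction e.support using Finset.induction_on with
    | empty =>
      simp only [Finset.prod_empty, Finset.sum_empty]
      refine ⟨fun e' he' => ?_, fun e' he' => ?_⟩
      · rw [← C_1, support_C, if_neg one_ne_zero, Finset.mem_singleton] at he'
        rw [he', map_zero]
      · rw [map_one, sub_self, support_zero] at he'
        exact absurd he' (Finset.notMem_empty _)
    | insert a s ha ih =>
      rw [Finset.prod_insert ha, Finset.sum_insert ha]
      refine bfba_pair_mul μ Φ ?_ ih
      -- powers of a variable
      induction e a with
      | zero =>
        simp only [pow_zero, zero_smul]
        refine ⟨fun e' he' => ?_, fun e' he' => ?_⟩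
        · rw [← C_1, support_C, if_neg one_ne_zero, Finset.mem_singleton] at he'
          rw [he', map_zero]
        · rw [map_one, sub_self, support_zero] at he'
          exact absurd he' (Finset.notMem_empty _)
      | succ q ihq =>
        rw [pow_succ, succ_nsmul]
        exact bfba_pair_mul μ Φ ihq (hX a)
  -- general polynomials
  intro ν D hD e he
  have hrepr : D = ∑ e' ∈ D.support, coeff e' D • monomial e' (1 : ℂ) := by
    conv_lhs => rw [D.as_sum]
    exact Finset.sum_congr rfl fun e' _ => by rw [smul_monomial, smul_eq_mul, mul_one]
  have hsum : Φ D - D = ∑ e' ∈ D.support, coeff e' D • (Φ (monomial e' 1) - monomial e' 1) := by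
    conv_lhs => rw [hrepr]
    rw [map_sum, ← Finset.sum_sub_distrib]
    refine Finset.sum_congr rfl fun e' _ => ?_
    rw [map_smul, smul_sub]
  rw [hsum] at he
  obtain ⟨e', he', hee'⟩ := Finset.mem_biUnion.1 (support_sum he)
  exact lt_of_lt_of_le ((hmon e').2 e (support_smul hee')) (hD e' he')

/-! ## Graded subspaces are stable under the diagonal part of `H₀` -/

/-- **Torus stability of graded subspaces.**  If `μ` has the genericity property (clause 4 of
`bfba_exists_weight`), a `μ`-graded subspace `L` of degree-`k` forms, `k ≤ m`, is stable under
`diag(d)` for every nowhere-zero `d` with the rank-one block pattern: on a weight component all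
monomials have the same character `∏ d_v^{e_v}`, so `diag(d)` acts on it by a scalar. [folklore] -/
theorem bfba_torus_stable {n m : ℕ} (μ : Fin m × Fin m → ℤ)
    (hμ4 : ∀ e e' : Fin m × Fin m →₀ ℕ, e.degree ≤ m → e'.degree ≤ m →
        Finsupp.weight μ e = Finsupp.weight μ e' →
        ∀ d : Fin m × Fin m → ℂ, (∀ v, d v ≠ 0) →
          (∀ i k j l : Fin m, m - n ≤ (i : ℕ) → m - n ≤ (k : ℕ) → m - n ≤ (j : ℕ) →
            m - n ≤ (l : ℕ) → d (i, j) * d (k, l) = d (i, l) * d (k, j)) →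
          ∏ v ∈ e.support, d v ^ e v = ∏ v ∈ e'.support, d v ^ e' v)
    (k : ℕ) (hk : k ≤ m) (L : Submodule ℂ (MvPolynomial (Fin m × Fin m) ℂ))
    (hL : L ≤ homogeneousSubmodule (Fin m × Fin m) ℂ k)
    (hgr : ∀ D ∈ L, ∀ ν : ℤ, weightedHomogeneousComponent μ ν D ∈ L)
    (d : Fin m × Fin m → ℂ) (hd : ∀ v, d v ≠ 0)
    (hpat : ∀ i k j l : Fin m, m - n ≤ (i : ℕ) → m - n ≤ (k : ℕ) → m - n ≤ (j : ℕ) →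
      m - n ≤ (l : ℕ) → d (i, j) * d (k, l) = d (i, l) * d (k, j)) :
    ∀ D ∈ L, linSubst (Fin m × Fin m) ℂ (Matrix.diagonal d) D ∈ L := by
  classical
  intro D hD
  rw [← cr_sum_comp (μ := μ) D, map_sum]
  refine L.sum_mem fun ν' _ => ?_
  set G := weightedHomogeneousComponent μ ν' D with hG
  have hGL : G ∈ L := hgr D hD ν'
  have hGhom : G.IsHomogeneous k := (mem_homogeneousSubmodule k G).1 (hL hGL)
  have hGwt : ∀ e ∈ G.support, Finsupp.weight μ e = ν' := by
    intro e he
    rw [mem_support_iff, hG, coeff_weightedHomogeneousComponent] at he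
    by_contra h
    exact he (if_neg h)
  have hGdeg : ∀ e ∈ G.support, e.degree = k := by
    intro e he
    rw [Finsupp.degree_eq_weight_one]
    exact hGhom (mem_support_iff.1 he)
  by_cases hG0 : G = 0
  · rw [hG0, map_zero]; exact L.zero_mem
  obtain ⟨e₀, he₀⟩ := Finset.nonempty_of_ne_empty (mt support_eq_empty.1 hG0)
  set χ : ℂ := ∏ v ∈ e₀.support, d v ^ e₀ v with hχ
  have hscal : linSubst (Fin m × Fin m) ℂ (Matrix.diagonal d) G = χ • G := by
    ext e
    rw [tli_coeff_linSubst_diagonal, coeff_smul, smul_eq_mul]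
    by_cases he : e ∈ G.support
    · rw [hμ4 e e₀ ((hGdeg e he).le.trans hk) ((hGdeg e₀ he₀).le.trans hk)
        ((hGwt e he).trans (hGwt e₀ he₀).symm) d hd hpat]
    · rw [notMem_support_iff.1 he, mul_zero, mul_zero]
  rw [hscal]
  exact L.smul_mem χ hGL

/-! ## W4 from gradedness and unipotent stability -/

/-- **The stability clause W4 from torus and unipotent stability.**  Let the `J k`, `k ≤ m`, be
`μ`-graded subspaces of degree-`k` forms (`μ` generic as in `bfba_exists_weight`), stable under every
unipotent lower-triangular `V` supported on the rows of the unused variables.  Then every invertible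
`M` satisfying (a)–(d) of the route statement maps each `J k` into itself by `D ↦ Mᵀ · D`:
`Mᵀ = V · diag(M)` with such a `V` (the diagonal of `M` is nowhere zero by
`bfba_det_eq_prod_diag`), `diag(M)` preserves `J k` by `bfba_torus_stable`, and `V` by assumption.
[folklore] -/
theorem bfba_W4_of_graded_of_unipotent (n m : ℕ) [NeZero m] (μ : Fin m × Fin m → ℤ)
    (hμ4 : ∀ e e' : Fin m × Fin m →₀ ℕ, e.degree ≤ m → e'.degree ≤ m →
        Finsupp.weight μ e = Finsupp.weight μ e' →
        ∀ d : Fin m × Fin m → ℂ, (∀ v, d v ≠ 0) →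
          (∀ i k j l : Fin m, m - n ≤ (i : ℕ) → m - n ≤ (k : ℕ) → m - n ≤ (j : ℕ) →
            m - n ≤ (l : ℕ) → d (i, j) * d (k, l) = d (i, l) * d (k, j)) →
          ∏ v ∈ e.support, d v ^ e v = ∏ v ∈ e'.support, d v ^ e' v)
    (J : ℕ → Set (MvPolynomial (Fin m × Fin m) ℂ))
    (hJsub : ∀ k ≤ m, ∃ Lk : Submodule ℂ (MvPolynomial (Fin m × Fin m) ℂ),
      (Lk : Set (MvPolynomial (Fin m × Fin m) ℂ)) = J k ∧ Lk ≤ homogeneousSubmodule (Fin m × Fin m) ℂ k)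
    (hgr : ∀ k ≤ m, ∀ D ∈ J k, ∀ ν : ℤ, weightedHomogeneousComponent μ ν D ∈ J k)
    (hU : ∀ V : Matrix (Fin m × Fin m) (Fin m × Fin m) ℂ, (∀ a, V a a = 1) →
      (∀ a b : Fin m × Fin m, a ≠ b → V a b ≠ 0 →
        ¬ ((m - n ≤ (a.1 : ℕ) ∧ m - n ≤ (a.2 : ℕ)) ∨ a = (0, 0)) ∧
          (if (m - n ≤ (b.1 : ℕ) ∧ m - n ≤ (b.2 : ℕ)) ∨ b = (0, 0) then 0 else m * m) +
              ((b.1 : ℕ) * m + (b.2 : ℕ)) <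
            (if (m - n ≤ (a.1 : ℕ) ∧ m - n ≤ (a.2 : ℕ)) ∨ a = (0, 0) then 0 else m * m) +
              ((a.1 : ℕ) * m + (a.2 : ℕ))) →
      ∀ k ≤ m, ∀ D ∈ J k, linSubst (Fin m × Fin m) ℂ V D ∈ J k)
    (M : Matrix (Fin m × Fin m) (Fin m × Fin m) ℂ) (hM : IsUnit M.det)
    (ha : ∀ i j : Fin m × Fin m, M j i ≠ 0 →
      (if (m - n ≤ (j.1 : ℕ) ∧ m - n ≤ (j.2 : ℕ)) ∨ j = (0, 0) then 0 else m * m) +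
          ((j.1 : ℕ) * m + (j.2 : ℕ)) ≤
        (if (m - n ≤ (i.1 : ℕ) ∧ m - n ≤ (i.2 : ℕ)) ∨ i = (0, 0) then 0 else m * m) +
          ((i.1 : ℕ) * m + (i.2 : ℕ)))
    (hb : ∀ i j : Fin m × Fin m, ((m - n ≤ (i.1 : ℕ) ∧ m - n ≤ (i.2 : ℕ)) ∨ i = (0, 0)) → j ≠ i →
      M j i = 0)
    (hc : ∀ i k j l : Fin m, m - n ≤ (i : ℕ) → m - n ≤ (k : ℕ) → m - n ≤ (j : ℕ) → m - n ≤ (l : ℕ) →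
      M (i, j) (i, j) * M (k, l) (k, l) = M (i, l) (i, l) * M (k, j) (k, j)) :
    ∀ k ≤ m, ∀ D ∈ J k, linSubst (Fin m × Fin m) ℂ Mᵀ D ∈ J k := by
  classical
  intro k hk D hD
  have hrkinj := bfba_rk_injective n m
  have htri : M.BlockTriangular (fun p : Fin m × Fin m =>
      (if (m - n ≤ (p.1 : ℕ) ∧ m - n ≤ (p.2 : ℕ)) ∨ p = (0, 0) then 0 else m * m) +
        ((p.1 : ℕ) * m + (p.2 : ℕ))) := by
    intro i j hij
    by_contra h
    exact absurd (ha j i h) (not_le.2 hij)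
  have hdiag : ∀ a, M a a ≠ 0 := by
    have h := hM.ne_zero
    rw [bfba_det_eq_prod_diag _ hrkinj M htri, Finset.prod_ne_zero_iff] at h
    exact fun a => h a (Finset.mem_univ a)
  -- `Mᵀ = V · diag(M)`
  set V : Matrix (Fin m × Fin m) (Fin m × Fin m) ℂ := fun a b => M b a / M b b with hV
  have hV1 : ∀ a, V a a = 1 := fun a => div_self (hdiag a)
  have hVS : ∀ a b : Fin m × Fin m, a ≠ b → V a b ≠ 0 →
      ¬ ((m - n ≤ (a.1 : ℕ) ∧ m - n ≤ (a.2 : ℕ)) ∨ a = (0, 0)) ∧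
        (if (m - n ≤ (b.1 : ℕ) ∧ m - n ≤ (b.2 : ℕ)) ∨ b = (0, 0) then 0 else m * m) +
            ((b.1 : ℕ) * m + (b.2 : ℕ)) <
          (if (m - n ≤ (a.1 : ℕ) ∧ m - n ≤ (a.2 : ℕ)) ∨ a = (0, 0) then 0 else m * m) +
            ((a.1 : ℕ) * m + (a.2 : ℕ)) := by
    intro a b hab hVab
    have hMba : M b a ≠ 0 := by
      intro h0
      apply hVab
      simp only [hV, h0, zero_div]
    refine ⟨fun hcore => hMba (hb a b hcore (Ne.symm hab)), ?_⟩
    exact lt_of_le_of_ne (ha a b hMba) fun h => hab (hrkinj h).symm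
  have hMt : Mᵀ = V * Matrix.diagonal fun a => M a a := by
    ext a b
    rw [Matrix.mul_diagonal, Matrix.transpose_apply]
    simp only [hV]
    rw [div_mul_cancel₀ _ (hdiag b)]
  rw [hMt, linSubst_mul, AlgHom.comp_apply]
  refine hU V hV1 hVS k hk _ ?_
  obtain ⟨Lk, hLk, hLkle⟩ := hJsub k hk
  have hmem : ∀ E, E ∈ Lk ↔ E ∈ J k := fun E => by rw [← SetLike.mem_coe, hLk]
  rw [← hmem]
  exact bfba_torus_stable μ hμ4 k hk Lk hLkle (fun E hE ν => (hmem _).2 (hgr k hk E ((hmem E).1 hE) ν))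
    (fun a => M a a) hdiag hc D ((hmem D).2 hD)

end Summit.ValiantsHypothesis.ValiantsHypothesis.Theorems.BorderApolarityBorelFixedBorderApolarity
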